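import Summits.NavierStokesRegularity.NavierStokesRegularity.Theses.TypeICertificateLadder
import Literature.Analysis.FluidPDE.TypeIAncientMild
import Literature.Analysis.FluidPDE.VectorCalculus
import HarnessLib.Audit

/-!
# Strategist sketch (wall-breaker edition) — crux `Target` ≡ `TypeICertificateLadder.NoTypeIBlowup`
# (stmt-NavierStokesRegularity-1217)

Typed forms of the NEW statements quoted in `STRATEGY-CENSUS.md` (unit cstrat-stmt-NavierStokesRegularity-1217-p1,
2026-08-17). Nothing here is filed as an item; the file certifies that the census signatures elaborate over existing
declarations. No `sorry`; the only theorems are bookkeeping. (The gen-0 strategist's signatures — `RateClassLiouville`,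
`RecurrentCoreLiouville`, `SpaceTimeTypeILiouville`, `NonSpreadingAtSomeSingularPoint`, `DescentBand`, `Rung` — live in
`Cruxes/Target/StrategistSketch.lean` and are not repeated.)
-/

noncomputable section

set_option linter.unusedVariables false
set_option linter.dupNamespace false

open Set Filter MeasureTheory Metric
open scoped Topology RealInnerProductSpace ContDiff

namespace Summit.NavierStokesRegularity.NavierStokesRegularity.Cruxes.Target.StrategistWB

local notation "ℝ³" => EuclideanSpace ℝ (Fin 3)

open Literature.Analysis.FluidPDE

/-- The crux, by name. -/
abbrev Crux : Prop :=
  Summit.NavierStokesRegularity.NavierStokesRegularity.Theses.TypeICertificateLadder.NoTypeIBlowup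

/-! ## Transfer T6 — the critical-space (ESS) sibling -/

/-- Weak final-time trace at `t = 0` of an ancient field: `u(t) ⇀ f` against smooth compactly supported tests. -/
def HasWeakTrace (u : ℝ → ℝ³ → ℝ³) (f : ℝ³ → ℝ³) : Prop :=
  ∀ φ : ℝ³ → ℝ³, ContDiff ℝ (⊤ : ℕ∞) φ → HasCompactSupport φ →
    Tendsto (fun t => ∫ x, ⟪u t x, φ x⟫) (𝓝[<] 0) (𝓝 (∫ x, ⟪f x, φ x⟫))

/-- T6 (2′) — TRACE RIGIDITY (backward uniqueness modulo scaling + Tsai): an apex-class Type-I ancient mild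
solution whose weak final trace is `(−1)`-homogeneous vanishes. Census verdict: NOT filed — exact homogeneity is a
selection (tangent traces are only recurrent), pairs/scaling derivatives meet pressure non-locality in the exterior
Carleman estimates, and across the apex backward uniqueness is linearly false-type for large constants. -/
def TraceRigidity : Prop :=
  ∀ C : ℝ, 0 < C → ∀ u : ℝ → ℝ³ → ℝ³, IsTypeIAncientMild C u →
    (∀ t < 0, ∀ x, ‖u t x‖ ≤ C / (‖x‖ + Real.sqrt (-t))) →
    ∀ f : ℝ³ → ℝ³, HasWeakTrace u f → (∀ r : ℝ, 0 < r → ∀ x, f (r • x) = r⁻¹ • f x) →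
    ∀ t < 0, ∀ x, u t x = 0

/-- T6 by-product (provable, M-sized; signature only) — NO ENERGY CONCENTRATION at a Type-I first blow-up time:
a classical Leray–Hopf rapidly-decaying-datum solution with the eventual Type-I rate converges STRONGLY in `L²`
as `t ↑ T` (the defect measure is `≪ 𝓗¹⌊S_T` by `ScaledEnergyBound`, and `𝓗¹(S_T) = 0`). -/
def NoEnergyConcentration : Prop :=
  ∀ C : ℝ, 0 < C → ∀ (ν T : ℝ), 0 < ν → 0 < T → ∀ (u : ℝ → ℝ³ → ℝ³) (p : ℝ → ℝ³ → ℝ),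
    IsClassicalNSSolutionOn (Ico 0 T) ν 0 u p → IsLerayHopfOn T ν 0 (u 0) u →
    HasRapidSpatialDecay (u 0) →
    (∀ᶠ t in 𝓝[<] T, ∀ x, Real.sqrt (T - t) * ‖u t x‖ ≤ C * Real.sqrt ν) →
    ∃ v : ℝ³ → ℝ³, MemLp v 2 ∧ Tendsto (fun t => ∫ x, ‖u t x - v x‖ ^ 2) (𝓝[<] T) (𝓝 0)

/-! ## Strengthen S⁺_dep — the depletion constant (the skeleton `Lines/depletion-ladder.lean` carries the same def) -/

/-- Stretching depletion with constant `κ` (Cauchy–Schwarz: `κ = 1` holds; conjecture: some `κ < 1/2`). -/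
def StretchingDepletion (κ : ℝ) : Prop :=
  ∀ (u : ℝ³ → ℝ³) (M : ℝ), ContDiff ℝ 2 u → VectorCalculus.IsDivFree u → (∀ x, ‖u x‖ ≤ M) →
    Integrable (fun x => ‖curl u x‖ ^ 2) →
    Integrable (fun x => frobeniusNormSq (fderiv ℝ (curl u) x)) →
    Integrable (fun x => ⟪curl u x, fderiv ℝ u x (curl u x)⟫) →
    |∫ x, ⟪curl u x, fderiv ℝ u x (curl u x)⟫| ≤
      κ * M * Real.sqrt (∫ x, ‖curl u x‖ ^ 2) * Real.sqrt (∫ x, frobeniusNormSq (fderiv ℝ (curl u) x))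

/-- The sharp depletion constant `κ̂` as a real number (infimum of admissible constants; `≤ 1`, `> 0`). -/
def depletionConstant : ℝ := sInf {κ : ℝ | 0 ≤ κ ∧ StretchingDepletion κ}

/-- The rung statement (shape of `LadderGlue`). -/
def Rung (C : ℝ) : Prop :=
  ∀ (ν T : ℝ), 0 < ν → 0 < T → ∀ (u : ℝ → ℝ³ → ℝ³) (p : ℝ → ℝ³ → ℝ),
    IsClassicalNSSolutionOn (Ico 0 T) ν 0 u p → IsLerayHopfOn T ν 0 (u 0) u →
    HasRapidSpatialDecay (u 0) →
    (∀ᶠ t in 𝓝[<] T, ∀ x, Real.sqrt (T - t) * ‖u t x‖ ≤ C * Real.sqrt ν) →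
    HasSmoothExtensionPast ν 0 u T

/-- S⁺_dep's rung law as a statement (skeleton stub S2): a depletion constant closes every rung below its
reciprocal. -/
def RungOfDepletion : Prop :=
  ∀ κ : ℝ, 0 < κ → StretchingDepletion κ → ∀ C : ℝ, 0 < C → κ * C < 1 → Rung C

/-- Bookkeeping: with the rung law, the reach of the ladder is `1/κ̂⁺` for any admissible `κ`. -/
theorem rung_of_admissible (hlaw : RungOfDepletion) {κ : ℝ} (hκ : 0 < κ) (hdep : StretchingDepletion κ)
    {C : ℝ} (hC : 0 < C) (hCκ : C < κ⁻¹) : Rung C :=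
  have h : κ * C < 1 := by rwa [lt_inv_comm₀ hC hκ, inv_eq_one_div, lt_div_iff₀ hC] at hCκ
  hlaw κ hκ hdep C hC h

/-! ## Decomposition (e) — the amplitude split at level two (children of the prepared `--split`) -/

/-- Child 1 (crux): rung two. -/
def RungTwo : Prop := Rung 2

/-- Child 2 (support): descent to rung two — the typed residual carrying the open Type-I Liouville problem. -/
def DescentToRungTwo : Prop :=
  ∀ C : ℝ, 2 ≤ C → ∀ (ν T : ℝ), 0 < ν → 0 < T → ∀ (u : ℝ → ℝ³ → ℝ³) (p : ℝ → ℝ³ → ℝ),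
    IsClassicalNSSolutionOn (Ico 0 T) ν 0 u p → IsLerayHopfOn T ν 0 (u 0) u →
    HasRapidSpatialDecay (u 0) →
    (∀ᶠ t in 𝓝[<] T, ∀ x, Real.sqrt (T - t) * ‖u t x‖ ≤ C * Real.sqrt ν) →
    ¬ HasSmoothExtensionPast ν 0 u T →
    ∀ᶠ t in 𝓝[<] T, ∀ x, Real.sqrt (T - t) * ‖u t x‖ ≤ 2 * Real.sqrt ν

/-- Glue of split (e) (the Theorems-shaped file `work/TypeICertificateLadderNoTypeIBlowupSplit.lean` proves it with
all Props expanded verbatim; here through the route's `LadderGlue_holds`). -/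
theorem crux_of_rungTwo_of_descentToRungTwo (hR2 : RungTwo) (hD2 : DescentToRungTwo) : Crux := by
  refine Summit.NavierStokesRegularity.NavierStokesRegularity.Theses.TypeICertificateLadder.LadderGlue_holds
    fun C _ => ?_
  intro ν T hν hT u p hcl hLH hdec hrate
  by_contra hext
  have hrate' : ∀ᶠ t in 𝓝[<] T, ∀ x, Real.sqrt (T - t) * ‖u t x‖ ≤ max C 2 * Real.sqrt ν := by
    filter_upwards [hrate] with t ht x
    exact (ht x).trans (mul_le_mul_of_nonneg_right (le_max_left _ _) (Real.sqrt_nonneg ν))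
  exact hext (hR2 ν T hν hT u p hcl hLH hdec (hD2 (max C 2) (le_max_right _ _) ν T hν hT u p hcl hLH hdec hrate' hext))

end Summit.NavierStokesRegularity.NavierStokesRegularity.Cruxes.Target.StrategistWB

end
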